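import Mathlib.Analysis.InnerProductSpace.PiL2
import Mathlib.Analysis.SpecialFunctions.Pow.Real
import Mathlib.Topology.MetricSpace.Thickening
import Literature.Analysis.FluidPDE.ConvexIntegration2DGeometry
import HarnessLib

/-!
# Convex integration in 2-D: the relaxed constitutive set and the geometric lemma

Topic `Analysis/FluidPDE`. Support file (layer 2 of 5) for the proof of `ConvexIntegrationLemma2DBall`
(Chiodaroli–De Lellis–Kreml 2015, Lemma 3.7 on a ball): CDK 2015, Def. 4.2 and Lemma 4.3 in
explicit coordinates. A state is `q = (a₁, a₂, γ, δ) : Fin 4 → ℝ` (velocity `a`, stress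
`[[γ, δ], [δ, -γ]]`), `M(q) = (C/2) Id - a ⊗ a + U` has entries `m11, m22, m12`, and

* `InU C q` (`𝒰`: `M ≻ 0`, i.e. `tr M > 0 ∧ det M > 0`), open; `InUbar C q` (`M ⪰ 0`), closed,
  bounded (`InUbar.coord_bound`), and `InUbar.entries_eq_zero`: `M ⪰ 0 ∧ tr M = 0 ⇒ M = 0`
  (i.e. `K^co ∩ {|a|² = C} = K`);
* `dirVec n μ = (n, 2μn₁n₂, μ(n₂² - n₁²))`, the segment directions (differences of points of `K`
  normalised), `entries_along_segment`: with the midpoint choice `μ = a · e` one has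
  `M(q + sD) = M(q) - (s² + 2s a·n) n ⊗ n`;
* `geometric_lemma` (CDK Lemma 4.3, explicit): for `q ∈ 𝒰` a segment `q ± ℓ D(n, μ) ⊂ 𝒰` with
  `0 < |μ| < √C` (a genuine Prop. 4.1 direction) and `ℓ ≥ (C - |a|²)/(8√C)`; the core
  `geometric_lemma_midpoint` takes `n ∥ M eᵢ` for the larger diagonal entry, `μ = a · e`,
  `ℓ = κ/(4√C)`, `κ = |Meᵢ|²/Mᵢᵢ`, and `μ ≠ 0` is then arranged by a small perturbation inside
  the open set `𝒰`; `geometric_lemma_local`: the same datum works with a uniform room `ρ` for all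
  nearby states (used cell by cell in CDK §4.1).

No matrices are used; the bridge from `Matrix.PosDef ((C/2) • 1 - (v₀ ⊗ v₀ - u₀))` to `InU`
is in the assembly file.

## Relation to `ConvexIntegration2DGeometry.lean`

The sibling file `ConvexIntegration2DGeometry.lean` (written for the decomposition of the parent
fact `ConvexIntegrationLemma2D`) describes the same objects in the coordinates
`(a, q) ∈ E² × E²` (`E² = EuclideanSpace ℝ (Fin 2)`): its `relaxedSet C` is `𝒰`, its
`mem_relaxedSet_iff_det` is literally `InU`, its `snd_eq_of_mem_closure` is `InUbar.entries_eq_zero`,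
and its `IsWaveData`/`waveVec` are the Prop. 4.1 segment data. The flat `Fin 4 → ℝ` coordinates of
the present file are the ones consumed by the analytic layers (`ConvexIntegration2DPotential`, the
plane waves, the step and the iteration, which handle perturbations as four scalar fields). The
two conventions are bridged here: `inU_iff_mem_relaxedSet` (`𝒰` agrees) and
`isWaveData_chord` / `waveVec_chord` (for `|n| = 1`, `0 < |μ| < √C`, the direction `dirVec n μ` is,
up to the positive factor `2√(C - μ²)`, the `waveVec` of the chord `a', b' = μ e ± √(C - μ²) n`,
which is Prop. 4.1 wave data).

## References

* E. Chiodaroli, C. De Lellis, O. Kreml, *Global ill-posedness of the isentropic system of gas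
  dynamics*, Comm. Pure Appl. Math. 68 (2015) 1157–1190, Def. 4.2, Lemma 4.3, §4.1.
-/

noncomputable section

open Set Metric Filter Function
open scoped Topology

namespace Literature.Analysis.FluidPDE.ConvexIntegration

/-- A state `q = (a₁, a₂, γ, δ)`: velocity `a = ṽ + v̲ ∈ ℝ²` and the two free entries of the
symmetric trace-free stress `ũ + u̲ = [[γ, δ], [δ, -γ]]`. [folklore] -/
abbrev State : Type := Fin 4 → ℝ

section Entries

variable (C : ℝ)

/-- Entry `M₁₁ = C/2 - a₁² + γ` of `M(q) = (C/2) Id - a ⊗ a + U`.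
[cite: ChiodaroliDeLellisKreml2015, Def. 4.2] -/
def m11 (q : State) : ℝ := C / 2 - q 0 ^ 2 + q 2

/-- Entry `M₂₂ = C/2 - a₂² - γ` of `M(q)`. [cite: ChiodaroliDeLellisKreml2015, Def. 4.2] -/
def m22 (q : State) : ℝ := C / 2 - q 1 ^ 2 - q 2

/-- Entry `M₁₂ = δ - a₁a₂` of `M(q)`. [cite: ChiodaroliDeLellisKreml2015, Def. 4.2] -/
def m12 (q : State) : ℝ := q 3 - q 0 * q 1

-- (`m12` does not depend on `C`.)

/-- `tr M(q) = C - |a|²`, the *defect*. [folklore] -/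
def trM (q : State) : ℝ := m11 C q + m22 C q

/-- `det M(q)`. [folklore] -/
def detM (q : State) : ℝ := m11 C q * m22 C q - m12 q ^ 2

/-- **The relaxed set `𝒰`** of CDK 2015, Def. 4.2: `a ⊗ a - U < (C/2) Id`, i.e. `M(q)` positive
definite, i.e. (for a symmetric `2 × 2` matrix) `tr M > 0` and `det M > 0`. This is
`relaxedSet C` of `ConvexIntegration2DGeometry.lean` in flat coordinates
(`inU_iff_mem_relaxedSet`). [cite: ChiodaroliDeLellisKreml2015, Def. 4.2] -/
def InU (q : State) : Prop := 0 < trM C q ∧ 0 < detM C q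

/-- The closed relaxation `M(q) ⪰ 0` (diagonal entries and determinant non-negative); it
contains the closure of `𝒰` (`closure_setOf_inU_subset`). [folklore] -/
def InUbar (q : State) : Prop := 0 ≤ m11 C q ∧ 0 ≤ m22 C q ∧ 0 ≤ detM C q

/-- The defect in coordinates: `tr M(q) = C - a₁² - a₂²`. [folklore] -/
theorem trM_eq (q : State) : trM C q = C - q 0 ^ 2 - q 1 ^ 2 := by
  simp only [trM, m11, m22]; ring

/-- Continuity of the entries of `M`. [folklore] -/
theorem continuous_m11 : Continuous (m11 C) := by unfold m11; fun_prop

/-- Continuity of the entries of `M`. [folklore] -/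
theorem continuous_m22 : Continuous (m22 C) := by unfold m22; fun_prop

/-- Continuity of the entries of `M`. [folklore] -/
theorem continuous_m12 : Continuous m12 := by unfold m12; fun_prop

/-- Continuity of the defect. [folklore] -/
theorem continuous_trM : Continuous (trM C) :=
  (continuous_m11 C).add (continuous_m22 C)

/-- Continuity of `det M`. [folklore] -/
theorem continuous_detM : Continuous (detM C) :=
  ((continuous_m11 C).mul (continuous_m22 C)).sub (continuous_m12.pow 2)

/-- `𝒰` is open. [folklore] -/
theorem isOpen_setOf_inU : IsOpen {q : State | InU C q} :=
  (isOpen_lt continuous_const (continuous_trM C)).inter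
    (isOpen_lt continuous_const (continuous_detM C))

/-- `{M ⪰ 0}` is closed. [folklore] -/
theorem isClosed_setOf_inUbar : IsClosed {q : State | InUbar C q} :=
  (isClosed_le continuous_const (continuous_m11 C)).inter
    ((isClosed_le continuous_const (continuous_m22 C)).inter
      (isClosed_le continuous_const (continuous_detM C)))

variable {C}

/-- On `𝒰`, `M₁₁ > 0`. [folklore] -/
theorem InU.m11_pos {q : State} (h : InU C q) : 0 < m11 C q := by
  rcases h with ⟨ht, hd⟩
  simp only [trM, detM] at ht hd
  by_contra h0
  push Not at h0
  nlinarith [sq_nonneg (m12 q)]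

/-- On `𝒰`, `M₂₂ > 0`. [folklore] -/
theorem InU.m22_pos {q : State} (h : InU C q) : 0 < m22 C q := by
  rcases h with ⟨ht, hd⟩
  simp only [trM, detM] at ht hd
  by_contra h0
  push Not at h0
  nlinarith [sq_nonneg (m12 q)]

/-- `𝒰 ⊆ {M ⪰ 0}`. [folklore] -/
theorem InU.inUbar {q : State} (h : InU C q) : InUbar C q :=
  ⟨h.m11_pos.le, h.m22_pos.le, h.2.le⟩

/-- `closure 𝒰 ⊆ {M ⪰ 0}`. [folklore] -/
theorem closure_setOf_inU_subset : closure {q : State | InU C q} ⊆ {q | InUbar C q} :=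
  closure_minimal (fun _ h => InU.inUbar h) (isClosed_setOf_inUbar C)

/-- On `M ⪰ 0` the defect is non-negative: `|a|² ≤ C`. [folklore] -/
theorem InUbar.trM_nonneg {q : State} (h : InUbar C q) : 0 ≤ trM C q := by
  simp only [trM]; linarith [h.1, h.2.1]

/-- `𝒰 ≠ ∅` forces `C > 0`. [folklore] -/
theorem InU.const_pos {q : State} (h : InU C q) : 0 < C := by
  have := h.1; rw [trM_eq] at this; nlinarith [sq_nonneg (q 0), sq_nonneg (q 1)]

/-- `{M ⪰ 0} ≠ ∅` forces `C ≥ 0`. [folklore] -/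
theorem InUbar.const_nonneg {q : State} (h : InUbar C q) : 0 ≤ C := by
  have := h.trM_nonneg; rw [trM_eq] at this; nlinarith [sq_nonneg (q 0), sq_nonneg (q 1)]

/-- **Boundedness of the relaxed set:** on `M ⪰ 0` every coordinate is bounded by `√C + 2C`.
[folklore] -/
theorem InUbar.coord_bound {q : State} (h : InUbar C q) (i : Fin 4) :
    |q i| ≤ Real.sqrt C + 2 * C := by
  have hC : 0 ≤ C := h.const_nonneg
  obtain ⟨h1, h2, h3⟩ := h
  simp only [m11, m22, detM, m12] at h1 h2 h3
  have hsC : 0 ≤ Real.sqrt C := Real.sqrt_nonneg C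
  have h0 : |q 0| ≤ Real.sqrt C := Real.abs_le_sqrt (by nlinarith [sq_nonneg (q 1)])
  have h1' : |q 1| ≤ Real.sqrt C := Real.abs_le_sqrt (by nlinarith [sq_nonneg (q 0)])
  have h2' : |q 2| ≤ C := abs_le.mpr ⟨by nlinarith [sq_nonneg (q 0)], by nlinarith [sq_nonneg (q 1)]⟩
  have hprod : |q 0 * q 1| ≤ C := by
    rw [abs_mul]
    calc |q 0| * |q 1| ≤ Real.sqrt C * Real.sqrt C := mul_le_mul h0 h1' (abs_nonneg _) hsC
      _ = C := Real.mul_self_sqrt hC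
  have h3' : |q 3| ≤ 2 * C := by
    have hb1 : C / 2 - q 0 ^ 2 + q 2 ≤ C := by nlinarith [sq_nonneg (q 0), sq_nonneg (q 1)]
    have hb2 : C / 2 - q 1 ^ 2 - q 2 ≤ C := by nlinarith [sq_nonneg (q 1), sq_nonneg (q 0)]
    have hsq3 : (q 3 - q 0 * q 1) ^ 2 ≤ C ^ 2 := by
      calc (q 3 - q 0 * q 1) ^ 2 ≤ (C / 2 - q 0 ^ 2 + q 2) * (C / 2 - q 1 ^ 2 - q 2) := by linarith
        _ ≤ C * C := mul_le_mul hb1 hb2 h2 hC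
        _ = C ^ 2 := (sq C).symm
    have h4 : |q 3 - q 0 * q 1| ≤ C := abs_le_of_sq_le_sq hsq3 hC
    calc |q 3| = |(q 3 - q 0 * q 1) + q 0 * q 1| := by ring_nf
      _ ≤ |q 3 - q 0 * q 1| + |q 0 * q 1| := abs_add_le _ _
      _ ≤ C + C := add_le_add h4 hprod
      _ = 2 * C := by ring
  fin_cases i
  · exact h0.trans (by linarith)
  · exact h1'.trans (by linarith)
  · exact h2'.trans (by linarith)
  · exact h3'.trans (by linarith)

/-- **`K^co ∩ {|a|² = C} = K`:** if `M(q) ⪰ 0` and `tr M(q) = 0` then `M(q) = 0`, i.e.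
`U = a ⊗ a - (C/2) Id` (the same statement as `snd_eq_of_mem_closure` of
`ConvexIntegration2DGeometry.lean`, in flat coordinates).
[cite: ChiodaroliDeLellisKreml2015, proof of Lemma 4.3 (the set `K_{√C}`)] -/
theorem InUbar.entries_eq_zero {q : State} (h : InUbar C q) (ht : trM C q = 0) :
    m11 C q = 0 ∧ m22 C q = 0 ∧ m12 q = 0 := by
  obtain ⟨h1, h2, h3⟩ := h
  simp only [trM] at ht
  have e1 : m11 C q = 0 := by linarith
  have e2 : m22 C q = 0 := by linarith
  refine ⟨e1, e2, ?_⟩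
  simp only [detM, e1, e2, zero_mul, zero_sub] at h3
  nlinarith [sq_nonneg (m12 q)]

end Entries

/-! ### Bridge to the `E² × E²` coordinates of `ConvexIntegration2DGeometry.lean` -/

/-- **`𝒰` in the two conventions agree:** `InU` at the flat coordinates of `(a, q)` is
membership in `relaxedSet C` (`mem_relaxedSet_iff_det`). [cite: ChiodaroliDeLellisKreml2015, Def. 4.2] -/
theorem inU_iff_mem_relaxedSet (C : ℝ)
    (z : EuclideanSpace ℝ (Fin 2) × EuclideanSpace ℝ (Fin 2)) :
    InU C ![z.1 0, z.1 1, z.2 0, z.2 1] ↔ z ∈ relaxedSet C := by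
  have e1 : trM C ![z.1 0, z.1 1, z.2 0, z.2 1] = C - (z.1 0 ^ 2 + z.1 1 ^ 2) := by
    simp [trM, m11, m22]; ring
  have e2 : detM C ![z.1 0, z.1 1, z.2 0, z.2 1]
      = (C / 2 - z.1 0 ^ 2 + z.2 0) * (C / 2 - z.1 1 ^ 2 - z.2 0) - (z.2 1 - z.1 0 * z.1 1) ^ 2 := by
    simp [detM, m11, m22, m12]
  rw [InU, e1, e2, mem_relaxedSet_iff_det]

/-! ### The segment directions and the geometric lemma -/

/-- The direction `D(n, μ) = (n₁, n₂, 2μ n₁n₂, μ(n₂² - n₁²))` in state space: velocity part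
`n`, stress part `μ(e ⊗ n + n ⊗ e)` with `e = (n₂, -n₁)`. For `|n| = 1`, `m = μe` with
`0 < |μ| < √C`, it is `(a' - b', a' ⊗ a' - b' ⊗ b') / |a' - b'|` for the chord `a', b' = m ± (…)n`
of the circle `|·|² = C` (then `|a'| = |b'| = √C` and `a' ≠ ±b'`, the segments of CDK
Prop. 4.1); `μ = 0` is the degenerate chord `a' = -b'` (pure velocity direction). The bridge to
the sibling's `waveVec`/`IsWaveData` is `waveVec_chord`/`isWaveData_chord` below.
[cite: ChiodaroliDeLellisKreml2015, Prop. 4.1 and Lemma 4.3] -/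
def dirVec (n : EuclideanSpace ℝ (Fin 2)) (μ : ℝ) : State :=
  ![n 0, n 1, 2 * μ * n 0 * n 1, μ * (n 1 ^ 2 - n 0 ^ 2)]

/-- `‖D(n, μ) - D(n, μ')‖ ≤ |μ - μ'|` (sup norm) for a unit vector `n`. [folklore] -/
theorem norm_dirVec_sub_le (n : EuclideanSpace ℝ (Fin 2)) (hn : n 0 ^ 2 + n 1 ^ 2 = 1) (μ μ' : ℝ) :
    ‖dirVec n μ - dirVec n μ'‖ ≤ |μ - μ'| := by
  refine (pi_norm_le_iff_of_nonneg (abs_nonneg _)).mpr fun i => ?_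
  have h2 : |2 * n 0 * n 1| ≤ 1 := by
    rw [abs_le]; constructor <;> nlinarith [sq_nonneg (n 0 + n 1), sq_nonneg (n 0 - n 1)]
  have h3 : |n 1 ^ 2 - n 0 ^ 2| ≤ 1 := by
    rw [abs_le]; constructor <;> nlinarith [sq_nonneg (n 0), sq_nonneg (n 1)]
  rw [Real.norm_eq_abs]
  fin_cases i
  · change |n 0 - n 0| ≤ _
    simp
  · change |n 1 - n 1| ≤ _
    simp
  · change |2 * μ * n 0 * n 1 - 2 * μ' * n 0 * n 1| ≤ _
    rw [show 2 * μ * n 0 * n 1 - 2 * μ' * n 0 * n 1 = (μ - μ') * (2 * n 0 * n 1) by ring, abs_mul]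
    exact mul_le_of_le_one_right (abs_nonneg _) h2
  · change |μ * (n 1 ^ 2 - n 0 ^ 2) - μ' * (n 1 ^ 2 - n 0 ^ 2)| ≤ _
    rw [show μ * (n 1 ^ 2 - n 0 ^ 2) - μ' * (n 1 ^ 2 - n 0 ^ 2) = (μ - μ') * (n 1 ^ 2 - n 0 ^ 2) by ring,
      abs_mul]
    exact mul_le_of_le_one_right (abs_nonneg _) h3

/-- The chord endpoint `a' = μ e + √(C - μ²) n` (`e = (n₂, -n₁)`) of the circle `|·|² = C`.
[cite: ChiodaroliDeLellisKreml2015, Prop. 4.1] -/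
def chordA (C : ℝ) (n : EuclideanSpace ℝ (Fin 2)) (μ : ℝ) : EuclideanSpace ℝ (Fin 2) :=
  μ • !₂[n 1, -n 0] + Real.sqrt (C - μ ^ 2) • n

/-- The chord endpoint `b' = μ e - √(C - μ²) n` (`e = (n₂, -n₁)`) of the circle `|·|² = C`.
[cite: ChiodaroliDeLellisKreml2015, Prop. 4.1] -/
def chordB (C : ℝ) (n : EuclideanSpace ℝ (Fin 2)) (μ : ℝ) : EuclideanSpace ℝ (Fin 2) :=
  μ • !₂[n 1, -n 0] - Real.sqrt (C - μ ^ 2) • n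

/-- **`dirVec n μ` is a Prop. 4.1 direction:** for `|n| = 1`, `0 < |μ| < √C` the chord
`a', b' = μ e ± √(C - μ²) n` is wave data in the sense of `IsWaveData` of
`ConvexIntegration2DGeometry.lean` (`|a'| = |b'| = √C`, `a' ≠ ±b'`).
[cite: ChiodaroliDeLellisKreml2015, Prop. 4.1] -/
theorem isWaveData_chord {C : ℝ} {n : EuclideanSpace ℝ (Fin 2)} (hn : n 0 ^ 2 + n 1 ^ 2 = 1) {μ : ℝ}
    (hμ : μ ≠ 0) (hμC : μ ^ 2 < C) : IsWaveData C 1 (chordA C n μ) (chordB C n μ) := by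
  set β := Real.sqrt (C - μ ^ 2) with hβ
  have hβ2 : β ^ 2 = C - μ ^ 2 := Real.sq_sqrt (by linarith)
  have hβpos : 0 < β := Real.sqrt_pos.mpr (by linarith)
  have hA0 : chordA C n μ 0 = μ * n 1 + β * n 0 := by simp [chordA, hβ]
  have hA1 : chordA C n μ 1 = -(μ * n 0) + β * n 1 := by simp [chordA, hβ]
  have hB0 : chordB C n μ 0 = μ * n 1 - β * n 0 := by simp [chordB, hβ]
  have hB1 : chordB C n μ 1 = -(μ * n 0) - β * n 1 := by simp [chordB, hβ]
  refine ⟨one_pos, ?_, ?_, fun h => ?_, fun h => ?_⟩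
  · rw [norm_sq_eq_two, hA0, hA1]; linear_combination (μ ^ 2 + β ^ 2) * hn + hβ2
  · rw [norm_sq_eq_two, hB0, hB1]; linear_combination (μ ^ 2 + β ^ 2) * hn + hβ2
  · have h0 := congrArg (fun x : EuclideanSpace ℝ (Fin 2) => x 0) h
    have h1 := congrArg (fun x : EuclideanSpace ℝ (Fin 2) => x 1) h
    simp only [hA0, hB0, hA1, hB1] at h0 h1
    have e0 : β * n 0 = 0 := by linarith
    have e1 : β * n 1 = 0 := by linarith
    have : β * (n 0 ^ 2 + n 1 ^ 2) = 0 := by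
      linear_combination (n 0) * e0 + (n 1) * e1
    rw [hn, mul_one] at this
    exact hβpos.ne' this
  · have h0 := congrArg (fun x : EuclideanSpace ℝ (Fin 2) => x 0) h
    have h1 := congrArg (fun x : EuclideanSpace ℝ (Fin 2) => x 1) h
    simp only [hA0, hB0, hA1, hB1, PiLp.neg_apply] at h0 h1
    have e0 : μ * n 1 = 0 := by linarith
    have e1 : μ * n 0 = 0 := by linarith
    have : μ * (n 0 ^ 2 + n 1 ^ 2) = 0 := by
      linear_combination (n 1) * e0 + (n 0) * e1
    rw [hn, mul_one] at this
    exact hμ this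

/-- **The two direction conventions agree:** the flat coordinates of
`waveVec 1 a' b'` for the chord `a', b' = μ e ± √(C - μ²) n` are `2√(C - μ²) · dirVec n μ`
(an identity of polynomials in `n, μ, √(C - μ²)`). [cite: ChiodaroliDeLellisKreml2015, Prop. 4.1] -/
theorem waveVec_chord (C : ℝ) (n : EuclideanSpace ℝ (Fin 2)) (μ : ℝ) :
    ![(waveVec 1 (chordA C n μ) (chordB C n μ)).1 0, (waveVec 1 (chordA C n μ) (chordB C n μ)).1 1,
      (waveVec 1 (chordA C n μ) (chordB C n μ)).2 0, (waveVec 1 (chordA C n μ) (chordB C n μ)).2 1]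
      = (2 * Real.sqrt (C - μ ^ 2)) • dirVec n μ := by
  set β := Real.sqrt (C - μ ^ 2) with hβ
  have hA0 : chordA C n μ 0 = μ * n 1 + β * n 0 := by simp [chordA, hβ]
  have hA1 : chordA C n μ 1 = -(μ * n 0) + β * n 1 := by simp [chordA, hβ]
  have hB0 : chordB C n μ 0 = μ * n 1 - β * n 0 := by simp [chordB, hβ]
  have hB1 : chordB C n μ 1 = -(μ * n 0) - β * n 1 := by simp [chordB, hβ]
  ext i
  fin_cases i
  · change (waveVec 1 (chordA C n μ) (chordB C n μ)).1 0 = 2 * β * n 0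
    simp [hA0, hB0]; ring
  · change (waveVec 1 (chordA C n μ) (chordB C n μ)).1 1 = 2 * β * n 1
    simp [hA1, hB1]; ring
  · change (waveVec 1 (chordA C n μ) (chordB C n μ)).2 0 = 2 * β * (2 * μ * n 0 * n 1)
    rw [waveVec_snd_apply_zero, hA0, hB0]; ring
  · change (waveVec 1 (chordA C n μ) (chordB C n μ)).2 1 = 2 * β * (μ * (n 1 ^ 2 - n 0 ^ 2))
    rw [waveVec_snd_apply_one, hA0, hA1, hB0, hB1]; ring

section Geometric

variable {C : ℝ}

/-- Entries of `M` along the segment `q + s D(n, μ)` with the *midpoint choice*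
`μ = a · e` (`e = (n₂, -n₁)`): `M(q + sD) = M(q) - (s² + 2s a·n) n ⊗ n`. [folklore] -/
theorem entries_along_segment (q : State) (n : EuclideanSpace ℝ (Fin 2))
    (hn : n 0 ^ 2 + n 1 ^ 2 = 1) (s : ℝ) :
    let μ := q 0 * n 1 - q 1 * n 0
    let g := s ^ 2 + 2 * s * (q 0 * n 0 + q 1 * n 1)
    m11 C (q + s • dirVec n μ) = m11 C q - g * n 0 ^ 2 ∧
    m22 C (q + s • dirVec n μ) = m22 C q - g * n 1 ^ 2 ∧
    m12 (q + s • dirVec n μ) = m12 q - g * (n 0 * n 1) := by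
  simp only [m11, m22, m12, dirVec, Pi.add_apply, Pi.smul_apply, smul_eq_mul,
    Matrix.cons_val_zero, Matrix.cons_val_one, Matrix.cons_val]
  refine ⟨?_, ?_, ?_⟩
  · linear_combination (2 * s * q 0 * n 0) * hn
  · linear_combination (2 * s * q 1 * n 1) * hn
  · linear_combination (s * (q 0 * n 1 + q 1 * n 0)) * hn

/-- The quantitative core of the geometric lemma: with `κ < d ≤ C`, `ℓ = κ/(4√C)`,
`|α| ≤ √C` and `|s| ≤ ℓ`, the quadratic `g = s² + 2sα` satisfies `g < (9/16+…)κ`, whence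
`d - g > 0` and `1 - g/κ > 0`. [folklore] -/
theorem core_ineq {d κ α ℓ s : ℝ} (hC : 0 < C) (hκ : 0 < κ) (hκd : κ < d) (hdC : d ≤ C)
    (hα : |α| ≤ Real.sqrt C) (hℓ : ℓ = κ / (4 * Real.sqrt C)) (hs : |s| ≤ ℓ) :
    0 < d - (s ^ 2 + 2 * s * α) ∧ 0 < 1 - (s ^ 2 + 2 * s * α) / κ := by
  have hsC : 0 < Real.sqrt C := Real.sqrt_pos.mpr hC
  have hsq : Real.sqrt C ^ 2 = C := Real.sq_sqrt hC.le
  have hℓ0 : 0 ≤ ℓ := by rw [hℓ]; positivity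
  have hs2 : s ^ 2 ≤ ℓ ^ 2 := by
    rw [← sq_abs s]; exact pow_le_pow_left₀ (abs_nonneg s) hs 2
  have hsα : 2 * s * α ≤ 2 * ℓ * Real.sqrt C := by
    have : s * α ≤ |s| * |α| := by
      rw [← abs_mul]; exact le_abs_self _
    nlinarith [abs_nonneg s, abs_nonneg α, mul_le_mul hs hα (abs_nonneg α) hℓ0]
  have h1 : 2 * ℓ * Real.sqrt C = κ / 2 := by rw [hℓ]; field_simp; ring
  have h2 : ℓ ^ 2 ≤ κ / 16 := by
    rw [hℓ, div_pow, mul_pow, hsq]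
    rw [div_le_div_iff₀ (by positivity) (by norm_num)]
    nlinarith
  have hg : s ^ 2 + 2 * s * α ≤ 9 / 16 * κ := by linarith
  constructor
  · linarith
  · rw [sub_pos, div_lt_one hκ]; linarith

/-- **Core of the geometric lemma (midpoint choice).** For every `q ∈ 𝒰` there are a unit
vector `n`, the parameter `μ = a · e` (`e = (n₂, -n₁)`; `μ² < C`, but `μ` may vanish) and a
half-length `ℓ ≥ tr M(q) / (8√C) = (C - |a|²)/(8√C)` such that the whole segment
`q + s D(n, μ)`, `|s| ≤ ℓ`, lies in `𝒰`. (Choice: `n ∥ M e_i` for the larger diagonal entry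
`M_ii`, `ℓ = κ/(4√C)` with `κ = |Me_i|²/M_ii ≥ tr M / 2`.) [folklore] -/
theorem geometric_lemma_midpoint {q : State} (hq : InU C q) :
    ∃ (n : EuclideanSpace ℝ (Fin 2)) (μ ℓ : ℝ), n 0 ^ 2 + n 1 ^ 2 = 1 ∧ μ ^ 2 < C ∧
      trM C q / (8 * Real.sqrt C) ≤ ℓ ∧ ∀ s : ℝ, |s| ≤ ℓ → InU C (q + s • dirVec n μ) := by
  have hC : 0 < C := hq.const_pos
  have hp := hq.m11_pos
  have ht := hq.m22_pos
  obtain ⟨htr, hdet⟩ := hq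
  have hsC : 0 < Real.sqrt C := Real.sqrt_pos.mpr hC
  set p := m11 C q
  set t := m22 C q
  set r := m12 q
  have hd_def : trM C q = p + t := rfl
  have hdet_def : detM C q = p * t - r ^ 2 := rfl
  rw [hdet_def] at hdet
  have hdC : p + t ≤ C := by
    have := trM_eq C q; rw [hd_def] at this; nlinarith [sq_nonneg (q 0), sq_nonneg (q 1)]
  -- `|a · n| ≤ √C` for every unit `n`
  have hαbound : ∀ n : EuclideanSpace ℝ (Fin 2), n 0 ^ 2 + n 1 ^ 2 = 1 →
      |q 0 * n 0 + q 1 * n 1| ≤ Real.sqrt C := by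
    intro n hn
    apply Real.abs_le_sqrt
    have htr' : q 0 ^ 2 + q 1 ^ 2 ≤ C := by
      have := trM_eq C q; rw [hd_def] at this; nlinarith
    nlinarith [sq_nonneg (q 0 * n 1 - q 1 * n 0)]
  -- `(a · e)² < C` for every unit `n`, `e = (n₂, -n₁)` (Lagrange's identity)
  have hμbound : ∀ n : EuclideanSpace ℝ (Fin 2), n 0 ^ 2 + n 1 ^ 2 = 1 →
      (q 0 * n 1 - q 1 * n 0) ^ 2 < C := by
    intro n hn
    have htr' : q 0 ^ 2 + q 1 ^ 2 < C := by
      have := trM_eq C q; rw [hd_def] at this; nlinarith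
    nlinarith [sq_nonneg (q 0 * n 0 + q 1 * n 1)]
  -- the two cases: which diagonal entry carries half of the trace
  rcases le_or_gt t p with hpt | hpt
  · -- Case `p ≥ t`: `n ∥ (p, r) = M e₁`
    set ρ := Real.sqrt (p ^ 2 + r ^ 2) with hρ_def
    have hρ2 : ρ ^ 2 = p ^ 2 + r ^ 2 := Real.sq_sqrt (by positivity)
    have hρ : 0 < ρ := Real.sqrt_pos.mpr (by positivity)
    set n : EuclideanSpace ℝ (Fin 2) := !₂[p / ρ, r / ρ] with hn_def
    have hn0 : n 0 = p / ρ := by simp [hn_def]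
    have hn1 : n 1 = r / ρ := by simp [hn_def]
    have hn : n 0 ^ 2 + n 1 ^ 2 = 1 := by
      rw [hn0, hn1, div_pow, div_pow, ← add_div, ← hρ2, div_self (pow_pos hρ 2).ne']
    set κ := (p ^ 2 + r ^ 2) / p with hκ_def
    have hκ : 0 < κ := by positivity
    have hκp : p ≤ κ := by
      rw [hκ_def, le_div_iff₀ hp]; nlinarith [sq_nonneg r]
    have hκd : κ < p + t := by
      rw [hκ_def, div_lt_iff₀ hp]; nlinarith
    set ℓ := κ / (4 * Real.sqrt C) with hℓ_def
    refine ⟨n, q 0 * n 1 - q 1 * n 0, ℓ, hn, hμbound n hn, ?_, fun s hs => ?_⟩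
    · rw [hd_def, hℓ_def, div_le_div_iff₀ (by positivity) (by positivity)]
      nlinarith [hsC.le]
    · obtain ⟨e1, e2, e3⟩ := entries_along_segment (C := C) q n hn s
      set g := s ^ 2 + 2 * s * (q 0 * n 0 + q 1 * n 1)
      obtain ⟨c1, c2⟩ := core_ineq hC hκ hκd hdC (hαbound n hn) hℓ_def hs
      refine ⟨?_, ?_⟩
      · simp only [trM, e1, e2]
        have : p - g * n 0 ^ 2 + (t - g * n 1 ^ 2) = (p + t) - g := by
          linear_combination (-g) * hn
        rw [this]; exact c1
      · simp only [detM, e1, e2, e3]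
        have hκρ : κ = ρ ^ 2 / p := by rw [hκ_def, hρ2]
        have key : (p - g * n 0 ^ 2) * (t - g * n 1 ^ 2) - (r - g * (n 0 * n 1)) ^ 2
            = (p * t - r ^ 2) * (1 - g / κ) := by
          rw [hn0, hn1, hκρ]
          field_simp
          ring
        rw [key]
        exact mul_pos hdet c2
  · -- Case `t > p`: `n ∥ (r, t) = M e₂`
    set ρ := Real.sqrt (r ^ 2 + t ^ 2) with hρ_def
    have hρ2 : ρ ^ 2 = r ^ 2 + t ^ 2 := Real.sq_sqrt (by positivity)
    have hρ : 0 < ρ := Real.sqrt_pos.mpr (by positivity)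
    set n : EuclideanSpace ℝ (Fin 2) := !₂[r / ρ, t / ρ] with hn_def
    have hn0 : n 0 = r / ρ := by simp [hn_def]
    have hn1 : n 1 = t / ρ := by simp [hn_def]
    have hn : n 0 ^ 2 + n 1 ^ 2 = 1 := by
      rw [hn0, hn1, div_pow, div_pow, ← add_div, ← hρ2, div_self (pow_pos hρ 2).ne']
    set κ := (r ^ 2 + t ^ 2) / t with hκ_def
    have hκ : 0 < κ := by positivity
    have hκt : t ≤ κ := by
      rw [hκ_def, le_div_iff₀ ht]; nlinarith [sq_nonneg r]
    have hκd : κ < p + t := by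
      rw [hκ_def, div_lt_iff₀ ht]; nlinarith
    set ℓ := κ / (4 * Real.sqrt C) with hℓ_def
    refine ⟨n, q 0 * n 1 - q 1 * n 0, ℓ, hn, hμbound n hn, ?_, fun s hs => ?_⟩
    · rw [hd_def, hℓ_def, div_le_div_iff₀ (by positivity) (by positivity)]
      nlinarith [hsC.le]
    · obtain ⟨e1, e2, e3⟩ := entries_along_segment (C := C) q n hn s
      set g := s ^ 2 + 2 * s * (q 0 * n 0 + q 1 * n 1)
      obtain ⟨c1, c2⟩ := core_ineq hC hκ hκd hdC (hαbound n hn) hℓ_def hs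
      refine ⟨?_, ?_⟩
      · simp only [trM, e1, e2]
        have : p - g * n 0 ^ 2 + (t - g * n 1 ^ 2) = (p + t) - g := by
          linear_combination (-g) * hn
        rw [this]; exact c1
      · simp only [detM, e1, e2, e3]
        have hκρ : κ = ρ ^ 2 / t := by rw [hκ_def, hρ2]
        have key : (p - g * n 0 ^ 2) * (t - g * n 1 ^ 2) - (r - g * (n 0 * n 1)) ^ 2
            = (p * t - r ^ 2) * (1 - g / κ) := by
          rw [hn0, hn1, hκρ]
          field_simp
          ring
        rw [key]
        exact mul_pos hdet c2

/-- **Geometric lemma (CDK 2015, Lemma 4.3), explicit two-dimensional form.** For every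
`q = (a, U) ∈ 𝒰` there are a unit vector `n`, a parameter `μ` with `0 < |μ| < √C` — so that
`D(n, μ)` is a genuine segment direction of CDK Prop. 4.1 (`|a'| = |b'| = √C`, `a' ≠ ±b'`) — and
a half-length `ℓ ≥ tr M(q)/(8√C) = (C - |a|²)/(8√C)` such that the whole segment
`q + s D(n, μ)`, `|s| ≤ ℓ`, lies in `𝒰`; in CDK's notation `σ = [-p, p]`, `p = ℓ D`,
`λ|b - a| = ℓ ≥ c₀ (C - |a|²)` with `c₀ = (8√C)⁻¹` (the printed "geometric constant" is
independent of `(a, U)`; its `C^{-1/2}` scaling is forced by the scaling `(a, U, C) ↦ (ta, t²U, t²C)`).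
(From the midpoint core by a small perturbation of `μ` inside the open set `𝒰`.)
[cite: ChiodaroliDeLellisKreml2015, Lemma 4.3] -/
theorem geometric_lemma {q : State} (hq : InU C q) :
    ∃ (n : EuclideanSpace ℝ (Fin 2)) (μ ℓ : ℝ), n 0 ^ 2 + n 1 ^ 2 = 1 ∧ (μ ≠ 0 ∧ μ ^ 2 < C) ∧
      trM C q / (8 * Real.sqrt C) ≤ ℓ ∧ ∀ s : ℝ, |s| ≤ ℓ → InU C (q + s • dirVec n μ) := by
  have hC : 0 < C := hq.const_pos
  obtain ⟨n, μ₀, ℓ, hn, hμ₀, hℓ, hseg⟩ := geometric_lemma_midpoint hq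
  by_cases hz : μ₀ ≠ 0
  · exact ⟨n, μ₀, ℓ, hn, ⟨hz, hμ₀⟩, hℓ, hseg⟩
  push Not at hz
  subst hz
  have hsC : 0 < Real.sqrt C := Real.sqrt_pos.mpr hC
  have hℓ0 : 0 ≤ ℓ := le_trans (by have := hq.1.le; positivity) hℓ
  -- the segment is a compact subset of the open set `𝒰`: room `ρ`
  set S : Set State := (fun s : ℝ => q + s • dirVec n 0) '' Icc (-ℓ) ℓ
  have hScpt : IsCompact S := isCompact_Icc.image (by fun_prop)
  have hSU : S ⊆ {y | InU C y} := by
    rintro _ ⟨s, hs, rfl⟩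
    exact hseg s (abs_le.mpr ⟨by linarith [hs.1], hs.2⟩)
  obtain ⟨ρ, hρ, hthick⟩ := hScpt.exists_cthickening_subset_open (isOpen_setOf_inU C) hSU
  -- perturb `μ = 0` to `μ = τ > 0`
  set τ : ℝ := min (ρ / (ℓ + 1)) (Real.sqrt C / 2) with hτ
  have hτpos : 0 < τ := lt_min (by positivity) (by positivity)
  have hτρ : ℓ * τ ≤ ρ := by
    calc ℓ * τ ≤ ℓ * (ρ / (ℓ + 1)) := by gcongr; exact min_le_left _ _
      _ = ρ * (ℓ / (ℓ + 1)) := by ring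
      _ ≤ ρ * 1 := by gcongr; rw [div_le_one (by linarith)]; linarith
      _ = ρ := mul_one ρ
  have hτC : τ ^ 2 < C := by
    have h1 : τ ≤ Real.sqrt C / 2 := min_le_right _ _
    have h2 : τ ^ 2 ≤ (Real.sqrt C / 2) ^ 2 := pow_le_pow_left₀ hτpos.le h1 2
    rw [div_pow, Real.sq_sqrt hC.le] at h2
    linarith
  refine ⟨n, τ, ℓ, hn, ⟨hτpos.ne', hτC⟩, hℓ, fun s hs => ?_⟩
  apply hthick
  rw [Metric.mem_cthickening_iff]
  have hmem : q + s • dirVec n 0 ∈ S := ⟨s, ⟨by linarith [(abs_le.mp hs).1], (abs_le.mp hs).2⟩, rfl⟩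
  refine le_trans (Metric.infEDist_le_edist_of_mem hmem) ?_
  rw [edist_dist]
  apply ENNReal.ofReal_le_ofReal
  rw [dist_eq_norm, add_sub_add_left_eq_sub, ← smul_sub, norm_smul, Real.norm_eq_abs]
  calc |s| * ‖dirVec n τ - dirVec n 0‖ ≤ ℓ * |τ - 0| :=
        mul_le_mul hs (norm_dirVec_sub_le n hn τ 0) (norm_nonneg _) hℓ0
    _ = ℓ * τ := by rw [sub_zero, abs_of_pos hτpos]
    _ ≤ ρ := hτρ

/-- **Local uniform geometric lemma.** Around every `q ∈ 𝒰` there is a radius `ρ > 0` and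
one segment datum `(n, μ, ℓ)` (`0 < |μ| < √C`) that works, with room `ρ`, for all `q'` within `ρ` of `q`:
`ℓ ≥ tr M(q')/(16√C)` and the `ρ`-neighbourhood of the segment `q' + sD`, `|s| ≤ ℓ`, lies
in `𝒰` (openness of `𝒰`, compactness of the segment, continuity of the defect).
[cite: ChiodaroliDeLellisKreml2015, §4.1 ("choose r > 0 so that … + σ ⊂ 𝒰 for any (x,t) ∈ B_r(x₀) × ]t₀-r, t₀+r[")] -/
theorem geometric_lemma_local {q : State} (hq : InU C q) :
    ∃ ρ : ℝ, 0 < ρ ∧ ∃ (n : EuclideanSpace ℝ (Fin 2)) (μ ℓ : ℝ), n 0 ^ 2 + n 1 ^ 2 = 1 ∧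
      (μ ≠ 0 ∧ μ ^ 2 < C) ∧ 0 ≤ ℓ ∧
      (∀ q' ∈ ball q ρ, trM C q' / (16 * Real.sqrt C) ≤ ℓ) ∧
      (∀ q' ∈ ball q ρ, ∀ s : ℝ, |s| ≤ ℓ →
        ∀ y ∈ closedBall (q' + s • dirVec n μ) ρ, InU C y) := by
  have hC : 0 < C := hq.const_pos
  obtain ⟨n, μ, ℓ, hn, hμ, hℓ, hseg⟩ := geometric_lemma hq
  have hsC : 0 < Real.sqrt C := Real.sqrt_pos.mpr hC
  have hdq : 0 < trM C q := hq.1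
  have hℓ0 : 0 ≤ ℓ := le_trans (by positivity) hℓ
  -- the segment is a compact subset of the open set `𝒰`
  set S : Set State := (fun s : ℝ => q + s • dirVec n μ) '' Icc (-ℓ) ℓ
  have hScpt : IsCompact S := (isCompact_Icc.image (by fun_prop))
  have hSU : S ⊆ {y | InU C y} := by
    rintro _ ⟨s, hs, rfl⟩
    exact hseg s (abs_le.mpr ⟨by linarith [hs.1], hs.2⟩)
  obtain ⟨ρ₁, hρ₁, hthick⟩ := hScpt.exists_cthickening_subset_open (isOpen_setOf_inU C) hSU
  -- continuity of the defect at `q`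
  have hcont : ∀ᶠ q' in 𝓝 q, trM C q' < 2 * trM C q :=
    (continuous_trM C).continuousAt.eventually (gt_mem_nhds (by linarith))
  obtain ⟨ρ₂, hρ₂, hball⟩ := Metric.eventually_nhds_iff_ball.mp hcont
  refine ⟨min (ρ₁ / 2) ρ₂, lt_min (by linarith) hρ₂, n, μ, ℓ, hn, hμ, hℓ0, ?_, ?_⟩
  · intro q' hq'
    have h1 : trM C q' < 2 * trM C q := hball q' (ball_subset_ball (min_le_right _ _) hq')
    calc trM C q' / (16 * Real.sqrt C) ≤ 2 * trM C q / (16 * Real.sqrt C) := by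
          gcongr
      _ = trM C q / (8 * Real.sqrt C) := by field_simp; ring
      _ ≤ ℓ := hℓ
  · intro q' hq' s hs y hy
    apply hthick
    rw [Metric.mem_cthickening_iff]
    have hmem : q + s • dirVec n μ ∈ S := ⟨s, ⟨by linarith [(abs_le.mp hs).1], (abs_le.mp hs).2⟩, rfl⟩
    refine le_trans (Metric.infEDist_le_edist_of_mem hmem) ?_
    rw [edist_dist]
    apply ENNReal.ofReal_le_ofReal
    have hq'2 : dist q' q < ρ₁ / 2 := lt_of_lt_of_le (mem_ball.mp hq') (min_le_left _ _)
    have hy2 : dist y (q' + s • dirVec n μ) ≤ ρ₁ / 2 :=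
      (mem_closedBall.mp hy).trans ((min_le_left _ _).trans le_rfl)
    calc dist y (q + s • dirVec n μ)
        ≤ dist y (q' + s • dirVec n μ) + dist (q' + s • dirVec n μ) (q + s • dirVec n μ) :=
          dist_triangle _ _ _
      _ = dist y (q' + s • dirVec n μ) + dist q' q := by rw [dist_add_right]
      _ ≤ ρ₁ / 2 + ρ₁ / 2 := add_le_add hy2 hq'2.le
      _ = ρ₁ := by ring

end Geometric

end Literature.Analysis.FluidPDE.ConvexIntegration
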